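import Literature.AnabelianGeometry.SemiGraphs.ArithTotalEstrangementSplitObstruction
import Literature.AnabelianGeometry.SemiGraphs.WitnessIwahoriBundle
import HarnessLib

/-!
# [SemiAnbd] Def 5.3 (ii) / Thm 5.4: total arithmetic estrangement FORCES an outer action with NON-OPEN
# kernel — the general obstruction behind the split-model case (non-vacuity boundary for `hest`)

Mochizuki, *Semi-graphs of anabelioids*, Publ. RIMS **42** (2006) 221–322, §5: Def 5.3 (i) "arithmetically
ample", Def 5.3 (ii) "arithmetically estranged / totally arithmetically estranged" p. 65, Thm 5.4 p. 66
("Suppose that `𝔊` is totally arithmetically estranged"), Ex 5.6 p. 67 (the `p`-adic situation: Frobenius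
acts on the cyclotomes of the nodes through an infinite quotient); §0 p. 5 (`G ⋊^out J`).
[cite: MochizukiSemiAnbd2006, Def 5.3 (ii), p. 65]

PROOF-ONLY file (abc-iut cell, L3 sub-DAG `plan/L3/SUBDAG-SemiAnbd-Thm54.md`, NV row «NV-L3
hest-needs-nontrivial-ρ» = «the general obstruction/inhabitation theory», L3-lead ruling α74, seat
abc-iut-w4-d040 gen 4).  No definition, no new named fact.  abc-iut-w6-d072's
`ArithTotalEstrangementSplitObstruction.lean` (p433406) shows that the T54-B capstones' design input
`hest : IsTotallyArithEstranged D aug` FAILS at the TRIVIAL outer action `ρ = 1`.  The mechanism is more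
general and is isolated here: for ANY outer action `ρ : Π_A → Out(π₁^temp 𝒢)` the pairs `(1, a)` with
`a ∈ ker ρ` lie in `π₁^temp(𝒢) ⋊^out Π_A`, CENTRALISE `ι(π₁^temp 𝒢)`, form a NORMAL subgroup, and therefore
sit inside every arithmetic decomposition group `Π^temp_{𝔊,v}`, `Π^temp_{𝔊,b}` of the produced data AND inside
every conjugate of one; so every `Π^temp_{𝔊,b} ∩ g Π^temp_{𝔊,b'} g⁻¹` surjects onto `ker ρ`.  Consequently:

* `isArithAmple_arithBrGp_inf_conj_of_isOpen_ker`: if `ker ρ` is OPEN in `Π_A`, every such intersection is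
  arithmetically ample;
* `not_isArithEstrangedEdge_of_two_branches_of_isOpen_ker` / `…_of_lt_of_isOpen_ker`: then no edge with two
  branches at a common vertex (first clause of Def 5.3 (ii), at `g = 1`), and no edge with a branch group
  properly inside its vertex group (second clause), is arithmetically estranged;
* `not_isTotallyArithEstranged_of_isOpen_ker` — **`hest` FAILS whenever `ker ρ` is open** and some vertex
  carries two distinct branches; contrapositive `not_isOpen_ker_of_isTotallyArithEstranged`: **total arithmetic
  estrangement forces the outer Galois action to be non-trivial on EVERY open subgroup of `Π_A`** (no open
  kernel — in particular `Π_A` cannot be finite-discrete, and `ρ` cannot factor through a finite quotient with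
  closed kernel of a compact `Π_A`: `not_isTotallyArithEstranged_of_finiteIndex_ker`);
* `IwahoriWitness.not_isTotallyArithEstranged_loopGraph_of_isOpen_ker`: at the tree's Thm-3.7 witness WITH
  an (estranged) edge, `loopGraph p` (abc-iut-w5-d236), `hest` fails for every outer action with open kernel.

The split case `ρ = 1` (`ker ρ = ⊤`) is abc-iut-w6-d072's theorem, recovered as
`not_isTotallyArithEstranged_of_trivial''` in one line (cited, not restated).  MEMO (no side taken): a
contentful non-vacuity witness of Thm 5.4's `hest` needs a semi-graph of anabelioids with an edge AND an outer
action `ρ` with non-open kernel (infinite image on every open subgroup — the Frobenius weights of Ex 5.6); no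
explicit chart of a `π₁^temp` with an edge exists in the tree (`TemperedPiChartExists` is abstract), so such a
witness is not constructible from tree objects tonight.  Nothing here bears on [IUTchIII] Cor. 3.12;
typed ≠ proved elsewhere.
-/

namespace Literature.AnabelianGeometry.SemiGraphs

universe u u' w

namespace ProfiniteSemiGraph

open Literature.AnabelianGeometry.EtaleTheta CategoryTheory Topology
open scoped Pointwise

variable {𝒢 : ProfiniteSemiGraph.{u}} (c : TemperedPiChart 𝒢) {PA : Type w} [Group PA]
  (ρ : PA →* TopOut c.G)

/-! ### The central copy of `ker ρ` inside `π₁^temp(𝒢) ⋊^out Π_A` -/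

/-- For `a ∈ ker ρ` the pair `(1, a)` lies in `π₁^temp(𝒢) ⋊^out Π_A` (`[1] = 1 = ρ(a)` in `Out`).
[cite: MochizukiSemiAnbd2006, §0 p.5] -/
theorem one_prod_mem_outerSemidirectProduct_of_mem_ker {a : PA} (ha : a ∈ ρ.ker) :
    ((1 : contMulAut c.G), a) ∈ outerSemidirectProduct ρ := by
  change TopOut.mk c.G 1 = ρ a
  rw [map_one, (MonoidHom.mem_ker).mp ha]

/-- The elements `(1, a)`, `a ∈ ker ρ`, CENTRALISE `ι(π₁^temp 𝒢)` (their `Aut`-component is the identity;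
`conj_toOuterSemidirectProduct`). [cite: MochizukiSemiAnbd2006, §0 p.5] -/
theorem conj_toOuterSemidirectProduct_one_prod_of_mem_ker {a : PA} (ha : a ∈ ρ.ker) (x : c.G) :
    (⟨((1 : contMulAut c.G), a), one_prod_mem_outerSemidirectProduct_of_mem_ker c ρ ha⟩ :
        outerSemidirectProduct ρ) * toOuterSemidirectProduct ρ x *
        (⟨((1 : contMulAut c.G), a), one_prod_mem_outerSemidirectProduct_of_mem_ker c ρ ha⟩ :
          outerSemidirectProduct ρ)⁻¹ =
      toOuterSemidirectProduct ρ x := by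
  rw [conj_toOuterSemidirectProduct]
  simp

/-- Conjugation by `(1, a)`, `a ∈ ker ρ`, fixes `ι(H)` for every `H ≤ π₁^temp(𝒢)`.
[cite: MochizukiSemiAnbd2006, §0 p.5] -/
theorem conjSubgroup_one_prod_map_of_mem_ker {a : PA} (ha : a ∈ ρ.ker) (H : Subgroup c.G) :
    conjSubgroup (⟨((1 : contMulAut c.G), a), one_prod_mem_outerSemidirectProduct_of_mem_ker c ρ ha⟩ :
        outerSemidirectProduct ρ) (H.map (toOuterSemidirectProduct ρ)) =
      H.map (toOuterSemidirectProduct ρ) := by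
  have hfix : ∀ k ∈ H.map (toOuterSemidirectProduct ρ),
      (⟨((1 : contMulAut c.G), a), one_prod_mem_outerSemidirectProduct_of_mem_ker c ρ ha⟩ :
          outerSemidirectProduct ρ) * k *
        (⟨((1 : contMulAut c.G), a), one_prod_mem_outerSemidirectProduct_of_mem_ker c ρ ha⟩ :
          outerSemidirectProduct ρ)⁻¹ = k := by
    rintro _ ⟨x, -, rfl⟩
    exact conj_toOuterSemidirectProduct_one_prod_of_mem_ker c ρ ha x
  ext y
  constructor
  · rintro ⟨k, hk, rfl⟩
    rw [MulEquiv.coe_toMonoidHom, MulAut.conj_apply, hfix k hk]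
    exact hk
  · intro hy
    exact ⟨y, hy, by rw [MulEquiv.coe_toMonoidHom, MulAut.conj_apply, hfix y hy]⟩

/-- An element normalising `U` commensurates it. [folklore] -/
private theorem mem_commensurator_of_conjSubgroup_eq {G : Type u'} [Group G] {U : Subgroup G} {g : G}
    (h : conjSubgroup g U = U) : g ∈ Subgroup.Commensurable.commensurator U := by
  rw [Subgroup.Commensurable.commensurator_mem_iff,
    show ConjAct.toConjAct g • U = conjSubgroup g U from rfl, h]

/-- `(1, a)`, `a ∈ ker ρ`, lies in the commensurator `C(ι H)` of every `ι(H)`.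
[cite: MochizukiSemiAnbd2006, §0 p.5] -/
theorem one_prod_mem_commensurator_map_of_mem_ker {a : PA} (ha : a ∈ ρ.ker) (H : Subgroup c.G) :
    (⟨((1 : contMulAut c.G), a), one_prod_mem_outerSemidirectProduct_of_mem_ker c ρ ha⟩ :
        outerSemidirectProduct ρ) ∈
      Subgroup.Commensurable.commensurator (H.map (toOuterSemidirectProduct ρ)) :=
  mem_commensurator_of_conjSubgroup_eq (conjSubgroup_one_prod_map_of_mem_ker c ρ ha H)

/-! ### `(1, a)`, `a ∈ ker ρ`, lies in every arithmetic decomposition group and every conjugate of one -/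

/-- `(1, a) ∈ Π^temp_{𝔊,v} = arithVertGp R ι v` for every vertex, whenever `a ∈ ker ρ`.
[cite: MochizukiSemiAnbd2006, Def 5.3 (ii), p. 65] -/
theorem one_prod_mem_arithVertGp_of_mem_ker (R : ChartRepresentatives c) {a : PA} (ha : a ∈ ρ.ker)
    (v : 𝒢.graph.Vertex) :
    (⟨((1 : contMulAut c.G), a), one_prod_mem_outerSemidirectProduct_of_mem_ker c ρ ha⟩ :
        outerSemidirectProduct ρ) ∈ arithVertGp R (toOuterSemidirectProduct ρ) v :=
  one_prod_mem_commensurator_map_of_mem_ker c ρ ha (R.Hv v)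

/-- `(1, a) ∈ Π^temp_{𝔊,b} = arithBrGp R ι b` for every branch (abutting or not), whenever `a ∈ ker ρ`.
[cite: MochizukiSemiAnbd2006, Def 5.3 (ii), p. 65] -/
theorem one_prod_mem_arithBrGp_of_mem_ker (R : ChartRepresentatives c) {a : PA} (ha : a ∈ ρ.ker)
    (b : 𝒢.graph.Branch) :
    (⟨((1 : contMulAut c.G), a), one_prod_mem_outerSemidirectProduct_of_mem_ker c ρ ha⟩ :
        outerSemidirectProduct ρ) ∈ arithBrGp R (toOuterSemidirectProduct ρ) b := by
  refine Subgroup.mem_inf.mpr ⟨?_, one_prod_mem_commensurator_map_of_mem_ker c ρ ha (R.Hb b)⟩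
  cases h : 𝒢.graph.abuts b with
  | none => simp
  | some v =>
    rw [Option.map_some, Option.getD_some]
    exact one_prod_mem_arithVertGp_of_mem_ker c ρ R ha v

/-- `(1, a)`, `a ∈ ker ρ`, lies in every CONJUGATE `g · Π^temp_{𝔊,b'} · g⁻¹`, `g ∈ π₁^temp(𝒢) ⋊^out Π_A`:
`g⁻¹ (1, a) g = (1, g₂⁻¹ a g₂)` with `g₂⁻¹ a g₂ ∈ ker ρ` (the kernel is normal).
[cite: MochizukiSemiAnbd2006, Def 5.3 (ii), p. 65] -/
theorem one_prod_mem_conjSubgroup_arithBrGp_of_mem_ker (R : ChartRepresentatives c) {a : PA}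
    (ha : a ∈ ρ.ker) (b : 𝒢.graph.Branch) (g : outerSemidirectProduct ρ) :
    (⟨((1 : contMulAut c.G), a), one_prod_mem_outerSemidirectProduct_of_mem_ker c ρ ha⟩ :
        outerSemidirectProduct ρ) ∈ conjSubgroup g (arithBrGp R (toOuterSemidirectProduct ρ) b) := by
  have ha' : g.1.2⁻¹ * a * g.1.2 ∈ ρ.ker := by
    simpa using (MonoidHom.normal_ker ρ).conj_mem a ha g.1.2⁻¹
  refine ⟨⟨((1 : contMulAut c.G), g.1.2⁻¹ * a * g.1.2), one_prod_mem_outerSemidirectProduct_of_mem_ker c ρ ha'⟩,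
    one_prod_mem_arithBrGp_of_mem_ker c ρ R ha' b, ?_⟩
  rw [MulEquiv.coe_toMonoidHom, MulAut.conj_apply]
  apply Subtype.ext
  refine Prod.ext ?_ ?_
  · simp
  · simp [mul_assoc]

/-! ### An open kernel makes every branch-pair intersection arithmetically ample -/

variable [TopologicalSpace PA]

/-- A subgroup of `π₁^temp(𝒢) ⋊^out Π_A` containing every `(1, a)`, `a ∈ ker ρ`, has `aug`-image `⊇ ker ρ`;
if `ker ρ` is OPEN (and `Π_A` has continuous multiplication) the image is open, i.e. the subgroup is
ARITHMETICALLY AMPLE (Def 5.3 (i)). [cite: MochizukiSemiAnbd2006, Def 5.3 (i), p. 65] -/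
theorem isArithAmple_of_forall_mem_ker_one_prod_mem [ContinuousMul PA] (hker : IsOpen (ρ.ker : Set PA))
    {K : Subgroup (outerSemidirectProduct ρ)}
    (hK : ∀ (a : PA) (ha : a ∈ ρ.ker),
      (⟨((1 : contMulAut c.G), a), one_prod_mem_outerSemidirectProduct_of_mem_ker c ρ ha⟩ :
        outerSemidirectProduct ρ) ∈ K) :
    IsArithAmple (outerSemidirectProductSnd ρ) K := by
  refine Subgroup.isOpen_mono (H₁ := ρ.ker) (fun a ha => ?_) hker
  exact ⟨_, hK a ha, rfl⟩

/-- **If `ker ρ` is open, every `Π^temp_{𝔊,b} ∩ g · Π^temp_{𝔊,b'} · g⁻¹` is arithmetically ample** — the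
negation of what Def 5.3 (ii) asks. [cite: MochizukiSemiAnbd2006, Def 5.3 (ii), p. 65] -/
theorem isArithAmple_arithBrGp_inf_conj_of_isOpen_ker [ContinuousMul PA] (hker : IsOpen (ρ.ker : Set PA))
    (R : ChartRepresentatives c) (b b' : 𝒢.graph.Branch) (g : outerSemidirectProduct ρ) :
    IsArithAmple (outerSemidirectProductSnd ρ)
      (arithBrGp R (toOuterSemidirectProduct ρ) b ⊓ conjSubgroup g (arithBrGp R (toOuterSemidirectProduct ρ) b')) :=
  isArithAmple_of_forall_mem_ker_one_prod_mem c ρ hker fun _ ha =>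
    Subgroup.mem_inf.mpr
      ⟨one_prod_mem_arithBrGp_of_mem_ker c ρ R ha b, one_prod_mem_conjSubgroup_arithBrGp_of_mem_ker c ρ R ha b' g⟩

/-! ### Def 5.3 (ii) fails when `ker ρ` is open -/

/-- **An edge with two distinct branches at one vertex (e.g. a LOOP) is NOT arithmetically estranged when
`ker ρ` is open** (Def 5.3 (ii), first clause, at `g = 1 ∈ Π^temp_{𝔊,v}`).
[cite: MochizukiSemiAnbd2006, Def 5.3 (ii), p. 65] -/
theorem not_isArithEstrangedEdge_of_two_branches_of_isOpen_ker [ContinuousMul PA]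
    (hker : IsOpen (ρ.ker : Set PA)) (R : ChartRepresentatives c)
    {v : 𝒢.graph.Vertex} {b b' : 𝒢.graph.Branch} (hbb' : b' ≠ b) (hb : 𝒢.graph.abuts b = some v)
    (hb' : 𝒢.graph.abuts b' = some v) :
    ¬ IsArithEstrangedEdge (decompositionDataOfChart R (toOuterSemidirectProduct ρ))
      (outerSemidirectProductSnd ρ) (𝒢.graph.edgeOf b) := fun h =>
  (h b rfl v hb 1 (Subgroup.one_mem _)).1 b' hb' hbb'
    (isArithAmple_arithBrGp_inf_conj_of_isOpen_ker c ρ hker R b b' 1)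

/-- **An edge with a branch whose arithmetic branch group is a PROPER subgroup of its vertex group is NOT
arithmetically estranged when `ker ρ` is open** (Def 5.3 (ii), second clause).
[cite: MochizukiSemiAnbd2006, Def 5.3 (ii), p. 65] -/
theorem not_isArithEstrangedEdge_of_lt_of_isOpen_ker [ContinuousMul PA] (hker : IsOpen (ρ.ker : Set PA))
    (R : ChartRepresentatives c) {v : 𝒢.graph.Vertex} {b : 𝒢.graph.Branch}
    (hb : 𝒢.graph.abuts b = some v) {g : outerSemidirectProduct ρ}
    (hgv : g ∈ arithVertGp R (toOuterSemidirectProduct ρ) v)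
    (hgb : g ∉ arithBrGp R (toOuterSemidirectProduct ρ) b) :
    ¬ IsArithEstrangedEdge (decompositionDataOfChart R (toOuterSemidirectProduct ρ))
      (outerSemidirectProductSnd ρ) (𝒢.graph.edgeOf b) := fun h =>
  (h b rfl v hb g hgv).2 hgb (isArithAmple_arithBrGp_inf_conj_of_isOpen_ker c ρ hker R b b g)

/-- **Total arithmetic estrangement FAILS whenever `ker ρ` is open and some vertex carries two distinct
branches.** [cite: MochizukiSemiAnbd2006, Thm 5.4, p. 66] -/
theorem not_isTotallyArithEstranged_of_isOpen_ker [ContinuousMul PA] (hker : IsOpen (ρ.ker : Set PA))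
    (R : ChartRepresentatives c) {v : 𝒢.graph.Vertex} {b b' : 𝒢.graph.Branch} (hbb' : b' ≠ b)
    (hb : 𝒢.graph.abuts b = some v) (hb' : 𝒢.graph.abuts b' = some v) :
    ¬ IsTotallyArithEstranged (decompositionDataOfChart R (toOuterSemidirectProduct ρ))
      (outerSemidirectProductSnd ρ) := fun h =>
  not_isArithEstrangedEdge_of_two_branches_of_isOpen_ker c ρ hker R hbb' hb hb' (h (𝒢.graph.edgeOf b))

/-- **MEMO FORM: total arithmetic estrangement (at a vertex with two branches) forces the outer Galois action
`ρ : Π_A → Out(π₁^temp 𝒢)` to have NON-OPEN kernel** — `ρ` is non-trivial on every open subgroup of `Π_A`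
(cf. Ex 5.6: Frobenius acts on the cyclotomes of the nodes through an infinite quotient).
[cite: MochizukiSemiAnbd2006, Thm 5.4, p. 66] -/
theorem not_isOpen_ker_of_isTotallyArithEstranged [ContinuousMul PA] (R : ChartRepresentatives c)
    {v : 𝒢.graph.Vertex} {b b' : 𝒢.graph.Branch} (hbb' : b' ≠ b) (hb : 𝒢.graph.abuts b = some v)
    (hb' : 𝒢.graph.abuts b' = some v)
    (hest : IsTotallyArithEstranged (decompositionDataOfChart R (toOuterSemidirectProduct ρ))
      (outerSemidirectProductSnd ρ)) :
    ¬ IsOpen (ρ.ker : Set PA) := fun hker =>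
  not_isTotallyArithEstranged_of_isOpen_ker c ρ hker R hbb' hb hb' hest

/-- **In a compact `Π_A`, an outer action through a FINITE quotient with CLOSED kernel is excluded by total
arithmetic estrangement** (a closed subgroup of finite index of a compact group is open).
[cite: MochizukiSemiAnbd2006, Thm 5.4, p. 66] -/
theorem not_isTotallyArithEstranged_of_finiteIndex_ker [IsTopologicalGroup PA] [CompactSpace PA]
    (hfin : ρ.ker.FiniteIndex) (hcl : IsClosed (ρ.ker : Set PA)) (R : ChartRepresentatives c)
    {v : 𝒢.graph.Vertex} {b b' : 𝒢.graph.Branch} (hbb' : b' ≠ b) (hb : 𝒢.graph.abuts b = some v)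
    (hb' : 𝒢.graph.abuts b' = some v) :
    ¬ IsTotallyArithEstranged (decompositionDataOfChart R (toOuterSemidirectProduct ρ))
      (outerSemidirectProductSnd ρ) :=
  haveI := hfin
  not_isTotallyArithEstranged_of_isOpen_ker c ρ (Subgroup.isOpen_of_isClosed_of_finiteIndex ρ.ker hcl) R
    hbb' hb hb'

/-- The split case `ρ = 1` (`ker ρ = ⊤` is open) — abc-iut-w6-d072's `not_isTotallyArithEstranged_of_trivial`,
recovered in one line from the open-kernel obstruction (instance-free form).
[cite: MochizukiSemiAnbd2006, Thm 5.4, p. 66] -/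
theorem not_isTotallyArithEstranged_of_trivial'' [ContinuousMul PA] (R : ChartRepresentatives c)
    {v : 𝒢.graph.Vertex} {b b' : 𝒢.graph.Branch} (hbb' : b' ≠ b) (hb : 𝒢.graph.abuts b = some v)
    (hb' : 𝒢.graph.abuts b' = some v) :
    ¬ IsTotallyArithEstranged
        (decompositionDataOfChart R (toOuterSemidirectProduct (1 : PA →* TopOut c.G)))
        (outerSemidirectProductSnd (1 : PA →* TopOut c.G)) :=
  not_isTotallyArithEstranged_of_isOpen_ker c 1
    (by rw [MonoidHom.ker_one, Subgroup.coe_top]; exact isOpen_univ) R hbb' hb hb'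

end ProfiniteSemiGraph

/-! ### At the Thm-3.7 witness with an estranged loop -/

namespace IwahoriWitness

open ProfiniteSemiGraph Literature.AnabelianGeometry.EtaleTheta

variable (p : ℕ) [Fact p.Prime] {PA : Type w} [Group PA] [TopologicalSpace PA] [ContinuousMul PA]

/-- **At `IwahoriWitness.loopGraph p`** (one vertex, one geometrically ESTRANGED loop; Thm 3.7's hypotheses
inhabited, `loopGraph_thm37Hypotheses`) **total arithmetic estrangement FAILS for every outer action with OPEN
kernel**, every chart, every `Π_A`, every choice of representatives.
[cite: MochizukiSemiAnbd2006, Thm 5.4, p. 66] -/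
theorem not_isTotallyArithEstranged_loopGraph_of_isOpen_ker (c : TemperedPiChart (loopGraph p))
    (ρ : PA →* TopOut c.G) (hker : IsOpen (ρ.ker : Set PA)) (R : ChartRepresentatives c) :
    ¬ IsTotallyArithEstranged (decompositionDataOfChart R (toOuterSemidirectProduct ρ))
      (outerSemidirectProductSnd ρ) := by
  obtain ⟨b₁, b₂, hne, -, -, -⟩ := (loopGraph p).graph.two_branches (ULift.up (0 : Fin 1))
  haveI : Subsingleton (loopGraph p).graph.Vertex := show Subsingleton PUnit from inferInstance
  obtain ⟨w₁, hw₁⟩ := Option.isSome_iff_exists.mp ((loopGraph_isGraph p).abuts_isSome b₁)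
  obtain ⟨w₂, hw₂⟩ := Option.isSome_iff_exists.mp ((loopGraph_isGraph p).abuts_isSome b₂)
  rw [Subsingleton.elim w₂ w₁] at hw₂
  exact not_isTotallyArithEstranged_of_isOpen_ker c ρ hker R hne.symm hw₁ hw₂

end IwahoriWitness

/-! ### v2 (append-only): the sharper criterion — no open subgroup of `Π_A` lifts to automorphisms
STABILISING a vertex representative together with two of its branch representatives

The open-kernel obstruction is the case `φ := 1` of the following: if on an OPEN subgroup `U ≤ Π_A` every
`a ∈ U` admits a representative `φ ∈ Aut_top(π₁^temp 𝒢)` of `ρ(a)` with `φ(Π_v) = Π_v`, `φ(Π_b) = Π_b`,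
`φ(Π_{b'}) = Π_{b'}` for the chosen representatives at a vertex `v` carrying the two branches `b ≠ b'`, then
the pairs `(φ, a)` lie in `Π^temp_{𝔊,b} ∩ Π^temp_{𝔊,b'}` (they normalise, hence commensurate, the three
`ι`-images), whose `aug`-image therefore contains `U`: Def 5.3 (ii)'s first clause fails at `g = 1`.  In the
`p`-adic situation of Ex 5.6 this is the familiar «`D_b ∩ D_{b'}` does not surject onto an open subgroup of
`G_K`»; the criterion is the definition's own first clause read on REPRESENTATIVES (stabilising ⇒
commensurating), so it is as sharp as a hypothesis on `ρ` alone can be without commensurator control.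
-/

namespace ProfiniteSemiGraph

open Literature.AnabelianGeometry.EtaleTheta CategoryTheory Topology

variable {𝒢 : ProfiniteSemiGraph.{u}} (c : TemperedPiChart 𝒢) {PA : Type w} [Group PA]
  (ρ : PA →* TopOut c.G)

/-- An element of `π₁^temp(𝒢) ⋊^out Π_A` whose `Aut`-component STABILISES `H ≤ π₁^temp(𝒢)` (`φ(H) = H`)
commensurates `ι(H)` (it normalises it: `g · ι(H) · g⁻¹ = ι(φ H)`, `conjSubgroup_map_toOuterSemidirectProduct`).
[cite: MochizukiSemiAnbd2006, §0 p.5] -/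
theorem mem_commensurator_map_of_map_eq (g : outerSemidirectProduct ρ) {H : Subgroup c.G}
    (hH : H.map (g.1.1 : MulAut c.G).toMonoidHom = H) :
    g ∈ Subgroup.Commensurable.commensurator (H.map (toOuterSemidirectProduct ρ)) :=
  mem_commensurator_of_conjSubgroup_eq (by rw [conjSubgroup_map_toOuterSemidirectProduct, hH])

/-- Such an element lies in `Π^temp_{𝔊,v} = arithVertGp R ι v` when it stabilises the vertex representative.
[cite: MochizukiSemiAnbd2006, Def 5.3 (ii), p. 65] -/
theorem mem_arithVertGp_of_map_eq (R : ChartRepresentatives c) (g : outerSemidirectProduct ρ)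
    {v : 𝒢.graph.Vertex} (hv : (R.Hv v).map (g.1.1 : MulAut c.G).toMonoidHom = R.Hv v) :
    g ∈ arithVertGp R (toOuterSemidirectProduct ρ) v :=
  mem_commensurator_map_of_map_eq c ρ g hv

/-- … and in `Π^temp_{𝔊,b} = arithBrGp R ι b` when it stabilises the vertex AND the branch representative
(`b` abutting to `v`). [cite: MochizukiSemiAnbd2006, Def 5.3 (ii), p. 65] -/
theorem mem_arithBrGp_of_map_eq (R : ChartRepresentatives c) (g : outerSemidirectProduct ρ)
    {v : 𝒢.graph.Vertex} {b : 𝒢.graph.Branch} (hb : 𝒢.graph.abuts b = some v)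
    (hv : (R.Hv v).map (g.1.1 : MulAut c.G).toMonoidHom = R.Hv v)
    (hbφ : (R.Hb b).map (g.1.1 : MulAut c.G).toMonoidHom = R.Hb b) :
    g ∈ arithBrGp R (toOuterSemidirectProduct ρ) b := by
  rw [arithBrGp_of_abuts R _ hb]
  exact Subgroup.mem_inf.mpr ⟨mem_arithVertGp_of_map_eq c ρ R g hv, mem_commensurator_map_of_map_eq c ρ g hbφ⟩

omit [Group PA] in
/-- Conjugating by `1` does nothing. [folklore] -/
private theorem conjSubgroup_one_eq {G : Type u'} [Group G] (K : Subgroup G) : conjSubgroup (1 : G) K = K := by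
  ext x
  constructor
  · rintro ⟨y, hy, rfl⟩
    simpa using hy
  · intro hx
    exact ⟨x, hx, by simp⟩

variable [TopologicalSpace PA] [ContinuousMul PA]

/-- **Stabilising lifts on an open subgroup make `Π^temp_{𝔊,b} ∩ Π^temp_{𝔊,b'}` arithmetically ample**: if
every `a` in an OPEN `U ≤ Π_A` has a representative `φ` of `ρ(a)` with `φ(Π_v) = Π_v`, `φ(Π_b) = Π_b`,
`φ(Π_{b'}) = Π_{b'}`, then `aug(Π^temp_{𝔊,b} ∩ 1·Π^temp_{𝔊,b'}·1⁻¹) ⊇ U` is open.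
[cite: MochizukiSemiAnbd2006, Def 5.3 (ii), p. 65] -/
theorem isArithAmple_arithBrGp_inf_of_open_stabilizing_lifts (R : ChartRepresentatives c)
    {v : 𝒢.graph.Vertex} {b b' : 𝒢.graph.Branch} (hb : 𝒢.graph.abuts b = some v)
    (hb' : 𝒢.graph.abuts b' = some v) (U : Subgroup PA) (hU : IsOpen (U : Set PA))
    (hlift : ∀ a ∈ U, ∃ φ : contMulAut c.G, TopOut.mk c.G φ = ρ a ∧
      (R.Hv v).map (φ : MulAut c.G).toMonoidHom = R.Hv v ∧
      (R.Hb b).map (φ : MulAut c.G).toMonoidHom = R.Hb b ∧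
      (R.Hb b').map (φ : MulAut c.G).toMonoidHom = R.Hb b') :
    IsArithAmple (outerSemidirectProductSnd ρ)
      (arithBrGp R (toOuterSemidirectProduct ρ) b ⊓
        conjSubgroup (1 : outerSemidirectProduct ρ) (arithBrGp R (toOuterSemidirectProduct ρ) b')) := by
  rw [conjSubgroup_one_eq]
  refine Subgroup.isOpen_mono (H₁ := U) (fun a ha => ?_) hU
  obtain ⟨φ, hφ, hv, hbφ, hb'φ⟩ := hlift a ha
  exact ⟨⟨(φ, a), hφ⟩, Subgroup.mem_inf.mpr
    ⟨mem_arithBrGp_of_map_eq c ρ R _ hb hv hbφ, mem_arithBrGp_of_map_eq c ρ R _ hb' hv hb'φ⟩, rfl⟩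

/-- **THE CRITERION: total arithmetic estrangement FAILS as soon as some open subgroup of `Π_A` lifts, element
by element, to automorphisms of `π₁^temp(𝒢)` stabilising a vertex representative `Π_v` together with two
distinct branch representatives `Π_b`, `Π_{b'}` at `v`** (Def 5.3 (ii), first clause, at `g = 1`).  The case
`U := ker ρ`, `φ := 1` is `not_isTotallyArithEstranged_of_isOpen_ker`.
[cite: MochizukiSemiAnbd2006, Thm 5.4, p. 66] -/
theorem not_isTotallyArithEstranged_of_open_stabilizing_lifts (R : ChartRepresentatives c)
    {v : 𝒢.graph.Vertex} {b b' : 𝒢.graph.Branch} (hbb' : b' ≠ b) (hb : 𝒢.graph.abuts b = some v)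
    (hb' : 𝒢.graph.abuts b' = some v) (U : Subgroup PA) (hU : IsOpen (U : Set PA))
    (hlift : ∀ a ∈ U, ∃ φ : contMulAut c.G, TopOut.mk c.G φ = ρ a ∧
      (R.Hv v).map (φ : MulAut c.G).toMonoidHom = R.Hv v ∧
      (R.Hb b).map (φ : MulAut c.G).toMonoidHom = R.Hb b ∧
      (R.Hb b').map (φ : MulAut c.G).toMonoidHom = R.Hb b') :
    ¬ IsTotallyArithEstranged (decompositionDataOfChart R (toOuterSemidirectProduct ρ))
      (outerSemidirectProductSnd ρ) := fun h =>
  (h (𝒢.graph.edgeOf b) b rfl v hb 1 (Subgroup.one_mem _)).1 b' hb' hbb'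
    (isArithAmple_arithBrGp_inf_of_open_stabilizing_lifts c ρ R hb hb' U hU hlift)

/-- **MEMO FORM of the criterion**: under total arithmetic estrangement, on EVERY open subgroup `U ≤ Π_A` some
`a ∈ U` has NO representative of `ρ(a)` stabilising `Π_v`, `Π_b`, `Π_{b'}` simultaneously — the outer Galois
action must keep MOVING each (vertex, branch, branch) triple on arbitrarily small open subgroups (Ex 5.6:
`D_b ∩ D_{b'}` has non-open image in `G_K`). [cite: MochizukiSemiAnbd2006, Thm 5.4, p. 66] -/
theorem exists_no_stabilizing_lift_of_isTotallyArithEstranged (R : ChartRepresentatives c)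
    {v : 𝒢.graph.Vertex} {b b' : 𝒢.graph.Branch} (hbb' : b' ≠ b) (hb : 𝒢.graph.abuts b = some v)
    (hb' : 𝒢.graph.abuts b' = some v)
    (hest : IsTotallyArithEstranged (decompositionDataOfChart R (toOuterSemidirectProduct ρ))
      (outerSemidirectProductSnd ρ))
    (U : Subgroup PA) (hU : IsOpen (U : Set PA)) :
    ∃ a ∈ U, ∀ φ : contMulAut c.G, TopOut.mk c.G φ = ρ a →
      ¬ ((R.Hv v).map (φ : MulAut c.G).toMonoidHom = R.Hv v ∧
          (R.Hb b).map (φ : MulAut c.G).toMonoidHom = R.Hb b ∧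
          (R.Hb b').map (φ : MulAut c.G).toMonoidHom = R.Hb b') := by
  by_contra hcon
  push Not at hcon
  exact not_isTotallyArithEstranged_of_open_stabilizing_lifts c ρ R hbb' hb hb' U hU
    (fun a ha => by
      obtain ⟨φ, hφ, h⟩ := hcon a ha
      exact ⟨φ, hφ, h⟩) hest

end ProfiniteSemiGraph

end Literature.AnabelianGeometry.SemiGraphs
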